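import Mathlib

/-!
# (P21) proved: Tao's popular-set proposition [Tao2006, Prop 4.5]
# (crux `LevelGradedCohnUmans.GradedDesignFamily`, stmt-MatrixMultiplication-7610; negative side,
# line `quadratic-extension-level-one-cell`, unit b2b-lgcu-subfield gen 18)

HONEST FRAMING.  This file proves hypothesis (P21) of `not_subfieldCell_of_popularSet`
(`Negative/SubfieldCellTao.lean`) — Tao's Proposition 4.5 of [Tao2006] (arXiv:math/0601431,
Prop. 21) for `n = 3` in the discrete setting: if `|A·A⁻¹| ≤ K|A|` then the set `S` of popular
quotients `s` (at least `|A|/2K` pairs `(b, c) ∈ A²` with `b⁻¹c = s`) is symmetric, contains `1`,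
has `|A| ≤ 2K|S|`, and `|A·S³·A⁻¹| ≤ 8K⁷|A|`.  Ingredients: the energy identity
`#{b⁻¹c = b'⁻¹c'} = #{c'c⁻¹ = b'b⁻¹}` (arXiv Lemma 19, `E(A,A⁻¹) = E(A⁻¹,A)`),
Cauchy–Schwarz, and Tao's change-of-variables injection `(x; (bᵢ, cᵢ)ᵢ) ↦ (a₀b₁⁻¹, c₁b₂⁻¹, c₂b₃⁻¹, c₃b₄⁻¹) ∈ (A·A⁻¹)⁴`.
Consequently Tao's product-set theorem (T) is fully kernel-checked from Mathlib, and
`¬S3 ⇐ (BGT) ∧ (Dickson)`; the two one-line corollaries (`taoProductSet`,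
`not_subfieldCell_of_BGT_Dickson`) are stated in the follow-up file `SubfieldCellBGTDickson.lean`
(this file imports only Mathlib).  NOT summit progress.

Sorry-free. [folklore]
-/

set_option linter.dupNamespace false

open scoped Pointwise

namespace Summit.MatrixMultiplication.MatrixMultiplication.Theorems.GradedDesignFamily.Negative

/-- A quotient fibre `{(b,c) ∈ A² : b⁻¹c = s}` has at most `|A|` elements. [folklore] -/
theorem quotFib_card_le {G : Type*} [Group G] [DecidableEq G] (A : Finset G) (s : G) :
    ((A ×ˢ A).filter fun q : G × G => q.1⁻¹ * q.2 = s).card ≤ A.card := by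
  refine Finset.card_le_card_of_injOn Prod.fst (fun q hq => ?_) (fun q hq q' hq' h => ?_)
  · exact (Finset.mem_product.1 (Finset.mem_filter.1 (Finset.mem_coe.1 hq)).1).1
  · have h1 := (Finset.mem_filter.1 (Finset.mem_coe.1 hq)).2
    have h2 := (Finset.mem_filter.1 (Finset.mem_coe.1 hq')).2
    refine Prod.ext h ?_
    have e : q.1⁻¹ * q.2 = q.1⁻¹ * q'.2 := by rw [h1, ← h2, h]
    exact mul_left_cancel e

/-- The quotient fibre of `s⁻¹` is at least as large as that of `s` (swap). [folklore] -/
theorem quotFib_card_le_inv {G : Type*} [Group G] [DecidableEq G] (A : Finset G) (s : G) :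
    ((A ×ˢ A).filter fun q : G × G => q.1⁻¹ * q.2 = s).card ≤
      ((A ×ˢ A).filter fun q : G × G => q.1⁻¹ * q.2 = s⁻¹).card := by
  refine Finset.card_le_card_of_injOn Prod.swap (fun q hq => ?_) (fun q _ q' _ h => ?_)
  · obtain ⟨hq, hs⟩ := Finset.mem_filter.1 (Finset.mem_coe.1 hq)
    obtain ⟨hb, hc⟩ := Finset.mem_product.1 hq
    refine Finset.mem_coe.2 (Finset.mem_filter.2 ⟨Finset.mem_product.2 ⟨hc, hb⟩, ?_⟩)
    simp only [Prod.fst_swap, Prod.snd_swap, ← hs, mul_inv_rev, inv_inv]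
  · exact Prod.swap_injective h

/-- The quotient fibre of `1` is the diagonal, of size at least `|A|`. [folklore] -/
theorem card_le_quotFib_one {G : Type*} [Group G] [DecidableEq G] (A : Finset G) :
    A.card ≤ ((A ×ˢ A).filter fun q : G × G => q.1⁻¹ * q.2 = 1).card := by
  refine Finset.card_le_card_of_injOn (fun b => (b, b)) (fun b hb => ?_) (fun b _ b' _ h => ?_)
  · exact Finset.mem_coe.2 (Finset.mem_filter.2
      ⟨Finset.mem_product.2 ⟨Finset.mem_coe.1 hb, Finset.mem_coe.1 hb⟩, inv_mul_cancel b⟩)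
  · exact (Prod.mk.injEq _ _ _ _ ▸ h).1

/-- **Energy lower bound** (Cauchy–Schwarz over `A·A⁻¹`):
`|A|⁴ ≤ |A·A⁻¹| · #{(b,b',c,c') ∈ A⁴ : c'c⁻¹ = b'b⁻¹}`. [folklore] -/
theorem quotEnergy_lower {G : Type*} [Group G] [DecidableEq G] (A : Finset G) :
    (A.card * A.card) ^ 2 ≤ (A * A⁻¹).card *
      ∑ p ∈ A ×ˢ A, ((A ×ˢ A).filter fun q : G × G => q.2 * q.1⁻¹ = p.2 * p.1⁻¹).card := by
  have hfib : (A ×ˢ A).card = ∑ y ∈ (A ×ˢ A).image (fun p : G × G => p.2 * p.1⁻¹),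
      ((A ×ˢ A).filter fun q : G × G => q.2 * q.1⁻¹ = y).card := by
    have h := Finset.card_eq_sum_card_fiberwise (f := fun p : G × G => p.2 * p.1⁻¹) (s := A ×ˢ A)
      (t := (A ×ˢ A).image (fun p : G × G => p.2 * p.1⁻¹)) (fun p hp => Finset.mem_image_of_mem _ hp)
    simpa only using h
  have hcomp : ∑ p ∈ A ×ˢ A, ((A ×ˢ A).filter fun q : G × G => q.2 * q.1⁻¹ = p.2 * p.1⁻¹).card =
      ∑ y ∈ (A ×ˢ A).image (fun p : G × G => p.2 * p.1⁻¹),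
        ((A ×ˢ A).filter fun q : G × G => q.2 * q.1⁻¹ = y).card *
          ((A ×ˢ A).filter fun q : G × G => q.2 * q.1⁻¹ = y).card := by
    have h := Finset.sum_comp (s := A ×ˢ A)
      (fun y => ((A ×ˢ A).filter fun q : G × G => q.2 * q.1⁻¹ = y).card)
      (fun p : G × G => p.2 * p.1⁻¹)
    simpa only [smul_eq_mul] using h
  have hCS := sq_sum_le_card_mul_sum_sq (s := (A ×ˢ A).image (fun p : G × G => p.2 * p.1⁻¹))
    (f := fun y => ((A ×ˢ A).filter fun q : G × G => q.2 * q.1⁻¹ = y).card)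
  have hI : ((A ×ˢ A).image (fun p : G × G => p.2 * p.1⁻¹)).card ≤ (A * A⁻¹).card :=
    Finset.card_le_card (Finset.image_subset_iff.2 fun p hp =>
      Finset.mul_mem_mul (Finset.mem_product.1 hp).2 (Finset.inv_mem_inv (Finset.mem_product.1 hp).1))
  calc (A.card * A.card) ^ 2 = ((A ×ˢ A).card) ^ 2 := by rw [Finset.card_product]
    _ = (∑ y ∈ (A ×ˢ A).image (fun p : G × G => p.2 * p.1⁻¹),
          ((A ×ˢ A).filter fun q : G × G => q.2 * q.1⁻¹ = y).card) ^ 2 := by rw [hfib]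
    _ ≤ ((A ×ˢ A).image (fun p : G × G => p.2 * p.1⁻¹)).card *
          ∑ y ∈ (A ×ˢ A).image (fun p : G × G => p.2 * p.1⁻¹),
            (((A ×ˢ A).filter fun q : G × G => q.2 * q.1⁻¹ = y).card) ^ 2 := hCS
    _ ≤ (A * A⁻¹).card *
          ∑ y ∈ (A ×ˢ A).image (fun p : G × G => p.2 * p.1⁻¹),
            (((A ×ˢ A).filter fun q : G × G => q.2 * q.1⁻¹ = y).card) ^ 2 :=
        Nat.mul_le_mul_right _ hI
    _ = _ := by
        rw [hcomp]
        exact congrArg _ (Finset.sum_congr rfl fun y _ => sq _)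

/-- **Energy switch** (`E(A,A⁻¹) = E(A⁻¹,A)`): the quadruple counts
`#{c'c⁻¹ = b'b⁻¹}` and `#{b'⁻¹c' = b⁻¹c}` over `A⁴` agree. [folklore] -/
theorem quotEnergy_switch {G : Type*} [Group G] [DecidableEq G] (A : Finset G) :
    ∑ p ∈ A ×ˢ A, ((A ×ˢ A).filter fun q : G × G => q.2 * q.1⁻¹ = p.2 * p.1⁻¹).card =
      ∑ p ∈ A ×ˢ A, ((A ×ˢ A).filter fun q : G × G => q.1⁻¹ * q.2 = p.1⁻¹ * p.2).card := by
  simp only [Finset.card_eq_sum_ones, Finset.sum_filter, Finset.sum_product]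
  refine Finset.sum_congr rfl fun b _ => ?_
  rw [Finset.sum_comm]
  refine Finset.sum_congr rfl fun c _ => Finset.sum_congr rfl fun b' _ =>
    Finset.sum_congr rfl fun c' _ => ?_
  refine if_congr ⟨fun h => ?_, fun h => ?_⟩ rfl rfl
  · calc b'⁻¹ * c' = b'⁻¹ * (c' * c⁻¹) * c := by group
      _ = b'⁻¹ * (b' * b⁻¹) * c := by rw [h]
      _ = b⁻¹ * c := by group
  · calc c' * c⁻¹ = b' * (b'⁻¹ * c') * c⁻¹ := by group
      _ = b' * (b⁻¹ * c) * c⁻¹ := by rw [h]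
      _ = b' * b⁻¹ := by group

/-- **Tao's change of variables** (proof of [Tao2006, Prop 4.5], `n = 3`): if every `s ∈ S` has
at least `m` representations `b⁻¹c` with `b, c ∈ A`, then `|A·S³·A⁻¹| · m³ ≤ |A·A⁻¹|⁴`. [folklore] -/
theorem popular_tripling_count {G : Type*} [Group G] [DecidableEq G] (A S : Finset G) (m : ℝ)
    (hm0 : 0 ≤ m)
    (hm : ∀ s ∈ S, m ≤ (((A ×ˢ A).filter fun q : G × G => q.1⁻¹ * q.2 = s).card : ℝ)) :
    ((A * S ^ 3 * A⁻¹).card : ℝ) * m ^ 3 ≤ ((A * A⁻¹).card : ℝ) ^ 4 := by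
  classical
  haveI : Nonempty G := ⟨1⟩
  have hrep : ∀ x ∈ A * S ^ 3 * A⁻¹, ∃ a₀ s₁ s₂ s₃ e : G, a₀ ∈ A ∧ s₁ ∈ S ∧ s₂ ∈ S ∧ s₃ ∈ S ∧
      e ∈ A⁻¹ ∧ x = a₀ * s₁ * s₂ * s₃ * e := by
    intro x hx
    rw [pow_succ, sq] at hx
    obtain ⟨w, hw, e, he, rfl⟩ := Finset.mem_mul.1 hx
    obtain ⟨a₀, ha₀, u, hu, rfl⟩ := Finset.mem_mul.1 hw
    obtain ⟨u', hu', s₃, hs₃, rfl⟩ := Finset.mem_mul.1 hu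
    obtain ⟨s₁, hs₁, s₂, hs₂, rfl⟩ := Finset.mem_mul.1 hu'
    exact ⟨a₀, s₁, s₂, s₃, e, ha₀, hs₁, hs₂, hs₃, he, by simp only [mul_assoc]⟩
  choose! fa f1 f2 f3 fe hfa hf1 hf2 hf3 hfe hxeq using hrep
  -- the injection `(x; (b₁,c₁),(b₂,c₂),(b₃,c₃)) ↦ (a₀ b₁⁻¹, c₁ b₂⁻¹, c₂ b₃⁻¹, c₃ e)`
  have hmaps : Set.MapsTo
      (fun z : (Σ _ : G, (G × G) × ((G × G) × (G × G))) =>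
        (fa z.1 * z.2.1.1⁻¹, (z.2.1.2 * z.2.2.1.1⁻¹, (z.2.2.1.2 * z.2.2.2.1⁻¹, z.2.2.2.2 * fe z.1))))
      ↑((A * S ^ 3 * A⁻¹).sigma fun x =>
        ((A ×ˢ A).filter fun q : G × G => q.1⁻¹ * q.2 = f1 x) ×ˢ
          (((A ×ˢ A).filter fun q : G × G => q.1⁻¹ * q.2 = f2 x) ×ˢ
            ((A ×ˢ A).filter fun q : G × G => q.1⁻¹ * q.2 = f3 x)))
      ↑((A * A⁻¹) ×ˢ ((A * A⁻¹) ×ˢ ((A * A⁻¹) ×ˢ (A * A⁻¹)))) := by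
    rintro ⟨x, ⟨b₁, c₁⟩, ⟨b₂, c₂⟩, ⟨b₃, c₃⟩⟩ hz
    rw [Finset.mem_coe, Finset.mem_sigma, Finset.mem_product, Finset.mem_product] at hz
    obtain ⟨hx, h1, h2, h3⟩ := hz
    rw [Finset.mem_filter, Finset.mem_product] at h1 h2 h3
    rw [Finset.mem_coe]
    simp only [Finset.mem_product]
    exact ⟨Finset.mul_mem_mul (hfa _ hx) (Finset.inv_mem_inv h1.1.1),
      Finset.mul_mem_mul h1.1.2 (Finset.inv_mem_inv h2.1.1),
      Finset.mul_mem_mul h2.1.2 (Finset.inv_mem_inv h3.1.1),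
      Finset.mul_mem_mul h3.1.2 (hfe _ hx)⟩
  have hinj : Set.InjOn
      (fun z : (Σ _ : G, (G × G) × ((G × G) × (G × G))) =>
        (fa z.1 * z.2.1.1⁻¹, (z.2.1.2 * z.2.2.1.1⁻¹, (z.2.2.1.2 * z.2.2.2.1⁻¹, z.2.2.2.2 * fe z.1))))
      ↑((A * S ^ 3 * A⁻¹).sigma fun x =>
        ((A ×ˢ A).filter fun q : G × G => q.1⁻¹ * q.2 = f1 x) ×ˢ
          (((A ×ˢ A).filter fun q : G × G => q.1⁻¹ * q.2 = f2 x) ×ˢ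
            ((A ×ˢ A).filter fun q : G × G => q.1⁻¹ * q.2 = f3 x))) := by
    rintro ⟨x, ⟨b₁, c₁⟩, ⟨b₂, c₂⟩, ⟨b₃, c₃⟩⟩ hz ⟨x', ⟨b₁', c₁'⟩, ⟨b₂', c₂'⟩, ⟨b₃', c₃'⟩⟩ hz' h
    rw [Finset.mem_coe, Finset.mem_sigma, Finset.mem_product, Finset.mem_product] at hz hz'
    obtain ⟨hx, h1, h2, h3⟩ := hz
    obtain ⟨hx', h1', h2', h3'⟩ := hz'
    rw [Finset.mem_filter, Finset.mem_product] at h1 h2 h3 h1' h2' h3'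
    simp only [Prod.mk.injEq] at h
    obtain ⟨e0, e1, e2, e3⟩ := h
    have ex : x = (fa x * b₁⁻¹) * (c₁ * b₂⁻¹) * (c₂ * b₃⁻¹) * (c₃ * fe x) := by
      calc x = fa x * f1 x * f2 x * f3 x * fe x := hxeq x hx
        _ = fa x * (b₁⁻¹ * c₁) * (b₂⁻¹ * c₂) * (b₃⁻¹ * c₃) * fe x := by rw [h1.2, h2.2, h3.2]
        _ = _ := by simp only [mul_assoc]
    have ex' : x' = (fa x' * b₁'⁻¹) * (c₁' * b₂'⁻¹) * (c₂' * b₃'⁻¹) * (c₃' * fe x') := by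
      calc x' = fa x' * f1 x' * f2 x' * f3 x' * fe x' := hxeq x' hx'
        _ = fa x' * (b₁'⁻¹ * c₁') * (b₂'⁻¹ * c₂') * (b₃'⁻¹ * c₃') * fe x' := by
            rw [h1'.2, h2'.2, h3'.2]
        _ = _ := by simp only [mul_assoc]
    have hxx : x = x' := by rw [ex, ex', e0, e1, e2, e3]
    subst hxx
    have hb₁ : b₁ = b₁' := inv_injective (mul_left_cancel e0)
    subst hb₁
    have hc₁ : c₁ = c₁' := mul_left_cancel (h1.2.trans h1'.2.symm)
    subst hc₁
    have hb₂ : b₂ = b₂' := inv_injective (mul_left_cancel e1)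
    subst hb₂
    have hc₂ : c₂ = c₂' := mul_left_cancel (h2.2.trans h2'.2.symm)
    subst hc₂
    have hb₃ : b₃ = b₃' := inv_injective (mul_left_cancel e2)
    subst hb₃
    have hc₃ : c₃ = c₃' := mul_left_cancel (h3.2.trans h3'.2.symm)
    subst hc₃
    rfl
  have hcount := Finset.card_le_card_of_injOn _ hmaps hinj
  rw [Finset.card_sigma] at hcount
  simp only [Finset.card_product] at hcount
  have hcountR : (∑ x ∈ A * S ^ 3 * A⁻¹,
      ((((A ×ˢ A).filter fun q : G × G => q.1⁻¹ * q.2 = f1 x).card : ℕ) : ℝ) *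
        ((((A ×ˢ A).filter fun q : G × G => q.1⁻¹ * q.2 = f2 x).card : ℝ) *
          (((A ×ˢ A).filter fun q : G × G => q.1⁻¹ * q.2 = f3 x).card : ℝ))) ≤
      ((A * A⁻¹).card : ℝ) ^ 4 := by
    have h : ((∑ x ∈ A * S ^ 3 * A⁻¹,
        ((A ×ˢ A).filter fun q : G × G => q.1⁻¹ * q.2 = f1 x).card *
          (((A ×ˢ A).filter fun q : G × G => q.1⁻¹ * q.2 = f2 x).card *
            ((A ×ˢ A).filter fun q : G × G => q.1⁻¹ * q.2 = f3 x).card) : ℕ) : ℝ) ≤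
        (((A * A⁻¹).card * ((A * A⁻¹).card * ((A * A⁻¹).card * (A * A⁻¹).card)) : ℕ) : ℝ) := by
      exact_mod_cast hcount
    have e4 : (((A * A⁻¹).card * ((A * A⁻¹).card * ((A * A⁻¹).card * (A * A⁻¹).card)) : ℕ) : ℝ) =
        ((A * A⁻¹).card : ℝ) ^ 4 := by push_cast; ring
    rw [e4] at h
    simpa only [Nat.cast_sum, Nat.cast_mul] using h
  have hlow : ∑ x ∈ A * S ^ 3 * A⁻¹, m ^ 3 ≤ ∑ x ∈ A * S ^ 3 * A⁻¹,
      ((((A ×ˢ A).filter fun q : G × G => q.1⁻¹ * q.2 = f1 x).card : ℕ) : ℝ) *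
        ((((A ×ˢ A).filter fun q : G × G => q.1⁻¹ * q.2 = f2 x).card : ℝ) *
          (((A ×ˢ A).filter fun q : G × G => q.1⁻¹ * q.2 = f3 x).card : ℝ)) := by
    refine Finset.sum_le_sum fun x hx => ?_
    have hm1 := hm _ (hf1 x hx)
    have hm2 := hm _ (hf2 x hx)
    have hm3 := hm _ (hf3 x hx)
    calc m ^ 3 = m * (m * m) := by ring
      _ ≤ _ := mul_le_mul hm1 (mul_le_mul hm2 hm3 hm0 (hm0.trans hm2)) (mul_nonneg hm0 hm0)
            (hm0.trans hm1)
  rw [Finset.sum_const, nsmul_eq_mul] at hlow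
  exact hlow.trans hcountR

/-- **(P21) — Tao's popular-set proposition** [Tao2006, Prop 4.5 (arXiv Prop 21), n = 3],
hypothesis of `taoProductSet_of_popularSet`, PROVED.  NOT summit progress. [folklore] -/
theorem popularSet_prop :
    ∀ (G : Type) [Group G] [DecidableEq G] (A : Finset G) (K : ℝ), A.Nonempty →
      ((A * A⁻¹).card : ℝ) ≤ K * A.card →
      ∃ S : Finset G, 1 ∈ S ∧ S⁻¹ = S ∧ (A.card : ℝ) ≤ 2 * K * S.card ∧
        ((A * S ^ 3 * A⁻¹).card : ℝ) ≤ 8 * K ^ 7 * A.card := by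
  intro G _ _ A K hA hK
  classical
  obtain ⟨a₀, ha₀⟩ := hA
  have hApos : (0 : ℝ) < A.card := by exact_mod_cast Finset.card_pos.2 ⟨a₀, ha₀⟩
  have hK1 : 1 ≤ K := by
    have h : (A.card : ℝ) ≤ (A * A⁻¹).card := by
      exact_mod_cast Finset.card_le_card_mul_right (Finset.Nonempty.inv ⟨a₀, ha₀⟩)
    have h' : (A.card : ℝ) * 1 ≤ A.card * K := by rw [mul_one, mul_comm]; exact h.trans hK
    exact le_of_mul_le_mul_left h' hApos
  have hK0 : 0 < K := by linarith
  refine ⟨((A ×ˢ A).image fun q : G × G => q.1⁻¹ * q.2).filter fun s =>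
      (A.card : ℝ) ≤ 2 * K * (((A ×ˢ A).filter fun q : G × G => q.1⁻¹ * q.2 = s).card : ℝ),
    ?_, ?_, ?_, ?_⟩
  · -- `1 ∈ S`
    refine Finset.mem_filter.2 ⟨Finset.mem_image.2 ⟨(a₀, a₀), Finset.mem_product.2 ⟨ha₀, ha₀⟩,
      inv_mul_cancel a₀⟩, ?_⟩
    have h1 : (A.card : ℝ) ≤ (((A ×ˢ A).filter fun q : G × G => q.1⁻¹ * q.2 = 1).card : ℝ) := by
      exact_mod_cast card_le_quotFib_one A
    have h0 : (0 : ℝ) ≤ (((A ×ˢ A).filter fun q : G × G => q.1⁻¹ * q.2 = 1).card : ℝ) :=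
      Nat.cast_nonneg _
    nlinarith
  · -- symmetry
    have hsym : ∀ s ∈ ((A ×ˢ A).image fun q : G × G => q.1⁻¹ * q.2).filter fun s =>
        (A.card : ℝ) ≤ 2 * K * (((A ×ˢ A).filter fun q : G × G => q.1⁻¹ * q.2 = s).card : ℝ),
        s⁻¹ ∈ ((A ×ˢ A).image fun q : G × G => q.1⁻¹ * q.2).filter fun s =>
          (A.card : ℝ) ≤ 2 * K * (((A ×ˢ A).filter fun q : G × G => q.1⁻¹ * q.2 = s).card : ℝ) := by
      intro s hs
      obtain ⟨hsJ, hsP⟩ := Finset.mem_filter.1 hs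
      obtain ⟨q, hq, hqs⟩ := Finset.mem_image.1 hsJ
      obtain ⟨hb, hc⟩ := Finset.mem_product.1 hq
      refine Finset.mem_filter.2 ⟨Finset.mem_image.2 ⟨(q.2, q.1), Finset.mem_product.2 ⟨hc, hb⟩, ?_⟩,
        ?_⟩
      · rw [← hqs, mul_inv_rev, inv_inv]
      · have h := quotFib_card_le_inv A s
        have h' : (((A ×ˢ A).filter fun q : G × G => q.1⁻¹ * q.2 = s).card : ℝ) ≤
            (((A ×ˢ A).filter fun q : G × G => q.1⁻¹ * q.2 = s⁻¹).card : ℝ) := by exact_mod_cast h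
        nlinarith
    ext s
    rw [Finset.mem_inv']
    constructor
    · intro h
      have h2 := hsym _ h
      rwa [inv_inv] at h2
    · intro h
      exact hsym _ h
  · -- `|A| ≤ 2K |S|` : energy
    have hE1 := quotEnergy_lower A
    rw [quotEnergy_switch A] at hE1
    have hE1R : ((A.card : ℝ) * A.card) ^ 2 ≤ ((A * A⁻¹).card : ℝ) *
        ∑ p ∈ A ×ˢ A, (((A ×ˢ A).filter fun q : G × G => q.1⁻¹ * q.2 = p.1⁻¹ * p.2).card : ℝ) := by
      exact_mod_cast hE1
    -- regroup the energy by quotient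
    have hcomp : ∑ p ∈ A ×ˢ A, (((A ×ˢ A).filter fun q : G × G => q.1⁻¹ * q.2 = p.1⁻¹ * p.2).card : ℝ) =
        ∑ s ∈ (A ×ˢ A).image (fun q : G × G => q.1⁻¹ * q.2),
          (((A ×ˢ A).filter fun q : G × G => q.1⁻¹ * q.2 = s).card : ℝ) *
            (((A ×ˢ A).filter fun q : G × G => q.1⁻¹ * q.2 = s).card : ℝ) := by
      have h := Finset.sum_comp (s := A ×ˢ A)
        (fun s => (((A ×ˢ A).filter fun q : G × G => q.1⁻¹ * q.2 = s).card : ℝ))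
        (fun q : G × G => q.1⁻¹ * q.2)
      simpa only [nsmul_eq_mul] using h
    have hfib : ∑ s ∈ (A ×ˢ A).image (fun q : G × G => q.1⁻¹ * q.2),
        (((A ×ˢ A).filter fun q : G × G => q.1⁻¹ * q.2 = s).card : ℝ) = (A.card : ℝ) * A.card := by
      have h := Finset.card_eq_sum_card_fiberwise (f := fun q : G × G => q.1⁻¹ * q.2) (s := A ×ˢ A)
        (t := (A ×ˢ A).image (fun q : G × G => q.1⁻¹ * q.2)) (fun p hp => Finset.mem_image_of_mem _ hp)
      rw [Finset.card_product] at h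
      have h' : ((A.card * A.card : ℕ) : ℝ) = ((∑ s ∈ (A ×ˢ A).image (fun q : G × G => q.1⁻¹ * q.2),
          ((A ×ˢ A).filter fun q : G × G => q.1⁻¹ * q.2 = s).card : ℕ) : ℝ) := by exact_mod_cast h
      rw [Nat.cast_sum] at h'
      rw [← h']
      push_cast
      ring
    -- split popular / unpopular
    have hsplit := Finset.sum_filter_add_sum_filter_not ((A ×ˢ A).image (fun q : G × G => q.1⁻¹ * q.2))
      (fun s => (A.card : ℝ) ≤ 2 * K * (((A ×ˢ A).filter fun q : G × G => q.1⁻¹ * q.2 = s).card : ℝ))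
      (fun s => (((A ×ˢ A).filter fun q : G × G => q.1⁻¹ * q.2 = s).card : ℝ) *
        (((A ×ˢ A).filter fun q : G × G => q.1⁻¹ * q.2 = s).card : ℝ))
    have hpop : ∑ s ∈ ((A ×ˢ A).image (fun q : G × G => q.1⁻¹ * q.2)).filter (fun s =>
        (A.card : ℝ) ≤ 2 * K * (((A ×ˢ A).filter fun q : G × G => q.1⁻¹ * q.2 = s).card : ℝ)),
        (((A ×ˢ A).filter fun q : G × G => q.1⁻¹ * q.2 = s).card : ℝ) *
          (((A ×ˢ A).filter fun q : G × G => q.1⁻¹ * q.2 = s).card : ℝ) ≤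
        ((((A ×ˢ A).image (fun q : G × G => q.1⁻¹ * q.2)).filter (fun s =>
          (A.card : ℝ) ≤ 2 * K * (((A ×ˢ A).filter fun q : G × G => q.1⁻¹ * q.2 = s).card : ℝ))).card
            : ℝ) * ((A.card : ℝ) * A.card) := by
      have h := Finset.sum_le_sum (s := ((A ×ˢ A).image (fun q : G × G => q.1⁻¹ * q.2)).filter (fun s =>
          (A.card : ℝ) ≤ 2 * K * (((A ×ˢ A).filter fun q : G × G => q.1⁻¹ * q.2 = s).card : ℝ)))
        (f := fun s => (((A ×ˢ A).filter fun q : G × G => q.1⁻¹ * q.2 = s).card : ℝ) *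
          (((A ×ˢ A).filter fun q : G × G => q.1⁻¹ * q.2 = s).card : ℝ))
        (g := fun _ => (A.card : ℝ) * A.card) (fun s _ => ?_)
      · rw [Finset.sum_const, nsmul_eq_mul] at h
        exact h
      · have hle : (((A ×ˢ A).filter fun q : G × G => q.1⁻¹ * q.2 = s).card : ℝ) ≤ A.card := by
          exact_mod_cast quotFib_card_le A s
        have h0 : (0 : ℝ) ≤ (((A ×ˢ A).filter fun q : G × G => q.1⁻¹ * q.2 = s).card : ℝ) :=
          Nat.cast_nonneg _
        exact mul_le_mul hle hle h0 (le_of_lt hApos)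
    have hunpop : ∑ s ∈ ((A ×ˢ A).image (fun q : G × G => q.1⁻¹ * q.2)).filter (fun s =>
        ¬ ((A.card : ℝ) ≤ 2 * K * (((A ×ˢ A).filter fun q : G × G => q.1⁻¹ * q.2 = s).card : ℝ))),
        (((A ×ˢ A).filter fun q : G × G => q.1⁻¹ * q.2 = s).card : ℝ) *
          (((A ×ˢ A).filter fun q : G × G => q.1⁻¹ * q.2 = s).card : ℝ) ≤
        (A.card : ℝ) / (2 * K) * ((A.card : ℝ) * A.card) := by
      have h := Finset.sum_le_sum (s := ((A ×ˢ A).image (fun q : G × G => q.1⁻¹ * q.2)).filter (fun s =>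
          ¬ ((A.card : ℝ) ≤ 2 * K * (((A ×ˢ A).filter fun q : G × G => q.1⁻¹ * q.2 = s).card : ℝ))))
        (f := fun s => (((A ×ˢ A).filter fun q : G × G => q.1⁻¹ * q.2 = s).card : ℝ) *
          (((A ×ˢ A).filter fun q : G × G => q.1⁻¹ * q.2 = s).card : ℝ))
        (g := fun s => (A.card : ℝ) / (2 * K) *
          (((A ×ˢ A).filter fun q : G × G => q.1⁻¹ * q.2 = s).card : ℝ)) (fun s hs => ?_)
      · refine h.trans ?_
        rw [← Finset.mul_sum]
        apply mul_le_mul_of_nonneg_left _ (by positivity)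
        rw [← hfib]
        exact Finset.sum_le_sum_of_subset_of_nonneg (Finset.filter_subset _ _)
          (fun s _ _ => Nat.cast_nonneg _)
      · have hlt := (Finset.mem_filter.1 hs).2
        rw [not_le] at hlt
        have h0 : (0 : ℝ) ≤ (((A ×ˢ A).filter fun q : G × G => q.1⁻¹ * q.2 = s).card : ℝ) :=
          Nat.cast_nonneg _
        have hle : (((A ×ˢ A).filter fun q : G × G => q.1⁻¹ * q.2 = s).card : ℝ) ≤
            (A.card : ℝ) / (2 * K) := by
          rw [le_div_iff₀ (by positivity)]
          linarith
        exact mul_le_mul_of_nonneg_right hle h0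
    -- combine
    rw [hcomp, ← hsplit] at hE1R
    have hAA : ((A * A⁻¹).card : ℝ) ≤ K * A.card := hK
    have hS0 : (0 : ℝ) ≤ ((((A ×ˢ A).image (fun q : G × G => q.1⁻¹ * q.2)).filter (fun s =>
        (A.card : ℝ) ≤ 2 * K * (((A ×ˢ A).filter fun q : G × G => q.1⁻¹ * q.2 = s).card : ℝ))).card
          : ℝ) := Nat.cast_nonneg _
    have htot : ((A.card : ℝ) * A.card) ^ 2 ≤ (K * A.card) *
        (((((A ×ˢ A).image (fun q : G × G => q.1⁻¹ * q.2)).filter (fun s =>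
          (A.card : ℝ) ≤ 2 * K * (((A ×ˢ A).filter fun q : G × G => q.1⁻¹ * q.2 = s).card : ℝ))).card
            : ℝ) * ((A.card : ℝ) * A.card) + (A.card : ℝ) / (2 * K) * ((A.card : ℝ) * A.card)) := by
      refine hE1R.trans ?_
      have hsum0 : (0 : ℝ) ≤ ((((A ×ˢ A).image (fun q : G × G => q.1⁻¹ * q.2)).filter (fun s =>
          (A.card : ℝ) ≤ 2 * K * (((A ×ˢ A).filter fun q : G × G => q.1⁻¹ * q.2 = s).card : ℝ))).card
            : ℝ) * ((A.card : ℝ) * A.card) + (A.card : ℝ) / (2 * K) * ((A.card : ℝ) * A.card) := by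
        positivity
      exact mul_le_mul hAA (add_le_add hpop hunpop) (add_nonneg
        (Finset.sum_nonneg fun _ _ => mul_nonneg (Nat.cast_nonneg _) (Nat.cast_nonneg _))
        (Finset.sum_nonneg fun _ _ => mul_nonneg (Nat.cast_nonneg _) (Nat.cast_nonneg _)))
        (by positivity)
    -- `a⁴ ≤ K a (|S| a² + a³/(2K))` ⇒ `a ≤ 2K|S|`
    have hdiv : (A.card : ℝ) / (2 * K) * (2 * K) = A.card := div_mul_cancel₀ _ (by positivity)
    nlinarith [hdiv, htot, hApos, hS0, hK0, pow_pos hApos 3]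
  · -- `|A S³ A⁻¹| ≤ 8 K⁷ |A|` : Tao's change of variables
    have hcnt := popular_tripling_count A
      (((A ×ˢ A).image fun q : G × G => q.1⁻¹ * q.2).filter fun s =>
        (A.card : ℝ) ≤ 2 * K * (((A ×ˢ A).filter fun q : G × G => q.1⁻¹ * q.2 = s).card : ℝ))
      ((A.card : ℝ) / (2 * K)) (by positivity) (fun s hs => by
        have h := (Finset.mem_filter.1 hs).2
        rw [div_le_iff₀ (by positivity)]
        linarith)
    have h4 : ((A * A⁻¹).card : ℝ) ^ 4 ≤ (K * A.card) ^ 4 :=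
      pow_le_pow_left₀ (Nat.cast_nonneg _) hK 4
    have hdiv : (A.card : ℝ) / (2 * K) * (2 * K) = A.card := div_mul_cancel₀ _ (by positivity)
    have hX0 : (0 : ℝ) ≤ ((A * (((A ×ˢ A).image fun q : G × G => q.1⁻¹ * q.2).filter fun s =>
        (A.card : ℝ) ≤ 2 * K * (((A ×ˢ A).filter fun q : G × G => q.1⁻¹ * q.2 = s).card : ℝ)) ^ 3 *
          A⁻¹).card : ℝ) := Nat.cast_nonneg _
    -- `X (a/2K)³ ≤ K⁴ a⁴` ⇒ `X a³ ≤ 8 K⁷ a⁴` ⇒ `X ≤ 8K⁷ a`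
    have h3 : ((A * (((A ×ˢ A).image fun q : G × G => q.1⁻¹ * q.2).filter fun s =>
        (A.card : ℝ) ≤ 2 * K * (((A ×ˢ A).filter fun q : G × G => q.1⁻¹ * q.2 = s).card : ℝ)) ^ 3 *
          A⁻¹).card : ℝ) * (A.card : ℝ) ^ 3 ≤ (8 * K ^ 7 * A.card) * (A.card : ℝ) ^ 3 := by
      have e : ((A.card : ℝ) / (2 * K)) ^ 3 * (2 * K) ^ 3 = (A.card : ℝ) ^ 3 := by
        rw [← mul_pow, hdiv]
      have h := mul_le_mul_of_nonneg_right (hcnt.trans h4) (show (0 : ℝ) ≤ (2 * K) ^ 3 by positivity)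
      rw [mul_assoc, e] at h
      refine h.trans (le_of_eq ?_)
      ring
    exact le_of_mul_le_mul_right h3 (pow_pos hApos 3)

end Summit.MatrixMultiplication.MatrixMultiplication.Theorems.GradedDesignFamily.Negative
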